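import Literature.AnabelianGeometry.SemiGraphs.SubgroupPresentationVertexGenerated
import Literature.AnabelianGeometry.SemiGraphs.SubgroupPresentationStabilizers
import Literature.AnabelianGeometry.SemiGraphs.ImmersionIntoTree
import HarnessLib

/-!
# A tree level is generated by its vertex groups over any connected lower level ([SemiAnbd] Thm 3.7 (iii) p. 41)

Mochizuki, *Semi-graphs of anabelioids*, Publ. RIMS **42** (2006), §3, proof of Thm. 3.7 (iii) p. 41
("`𝒢_{∞,i} → 𝒢_i` for the covering of `𝒢_i` determined by the universal graph-covering of the underlying
semi-graph `𝔾_i`"; Prop. 3.6 p. 38: its deck group `π₁(𝔾_i) = ker (π₁^temp(𝒢_i) ↠ ·)` is what is LEFT of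
`π₁^temp(𝒢_i)` after the verticial subgroups) [cite: MochizukiSemiAnbd2006, Thm 3.7(iii) p.41], and §1
Prop. 1.1 p. 14 (immersions of connected graphs into trees are embeddings — the graph-theoretic engine,
`SemiGraph.hom_injective_of_locallyInjective`, `ImmersionIntoTree.lean`).

PURE GROUP THEORY + SEMI-GRAPH COMBINATORICS (cell row T54-B, plan/GAP-LEDGER.md G-w4d053-1, sub-row
**T54·E1c** of abc-iut-L3-d4's decomposition; consumer: the binder `hgen` of
`GaloisLevelData.hK_of_vertGen`, `TemperedPiVertexGenerated.lean`).  In abc-iut-L3-d4's coset-semigraph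
currency (`SubgroupPresentation.cosetGraph`, `deckAct`, `cosetGraphTrans`, `vertSup`):

* `SemiGraph.nodeMap_injective_of_free_of_isTree` — the Bass–Serre-type engine: if a group `Q` acts on a
  CONNECTED semi-graph `Y` over `π : Y ⟶ T`, transitively on the fibres of `π` on edges, and FREELY on
  vertices in the weak sense "an element fixing a vertex acts trivially", and `T` is a TREE, then the node
  map of `π` on barycentric subdivisions is injective (it is locally injective — at a vertex node by the
  freeness, elsewhere by `branchMap_injOn` — and Prop. 1.1's engine applies); "a free action on a connected
  semi-graph with tree quotient is trivial";
* `SubgroupPresentation.vertSup_normal` — `vertSup N` is normal for normal `N`;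
* `SubgroupPresentation.mem_of_deckAct_vMk_eq` — for levels `vertSup N ≤ L ≤ N` (`L`, `N` normal) an element
  of `N` fixing a vertex of `P.cosetGraph L` lies in `L` (the vertex stabilisers of `N` are the
  `(N ∩ y⁻¹ H_w y)·L`);
* `SubgroupPresentation.exists_deckAct_eMk_eq` — the fibres of `cosetGraph L ⟶ cosetGraph N` on edges are
  `N`-orbits of the deck action;
* `SubgroupPresentation.isConnected_cosetGraph_of_le` — connectedness passes up the transition maps;
* **`SubgroupPresentation.le_of_isTree_of_vertSup_le`** / **`le_sup_vertSup_of_isTree`** — if `K ≤ N` are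
  normal levels with `P.cosetGraph K` connected and `P.cosetGraph N` a TREE (and `𝔾` has a vertex), then
  `N ≤ K ⊔ P.vertSup N`: the tree level `N` is generated, over `K`, by its vertex groups `N ∩ g H_w g⁻¹`.

Nothing here refers to the IUT corpus; no side is taken on [IUTchIII] Cor 3.12.
-/

namespace Literature.AnabelianGeometry.SemiGraphs

namespace SemiGraph

open CategoryTheory
open scoped Pointwise

universe v u

/-! ### The engine: a free action with orbit fibres over a tree is trivial -/

/-- **Bass–Serre-type engine** (the combinatorial heart of [SemiAnbd] Thm. 3.7 (iii), run on Prop. 1.1's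
engine): a group `Q` acts on the connected semi-graph `Y` by automorphisms over `π : Y ⟶ T`, transitively
on the edge fibres of `π`, and an element of `Q` fixing a vertex acts trivially; if `T` is a tree, the node
map of `π` on barycentric subdivisions is injective.  (Local injectivity at a vertex node `v`: two branches
`b₁, b₂` at `v` with the same image lie on edges in one `Q`-orbit, `q e₁ = e₂`; then `q b₁ = b₂` by
injectivity of `π` on the branches of `e₂`, so `q v = v`, so `q` acts trivially and `b₁ = b₂`.)
[cite: MochizukiSemiAnbd2006, Thm 3.7(iii) p.41] -/
theorem nodeMap_injective_of_free_of_isTree {Y T : SemiGraph.{u}} (π : Y ⟶ T) {Q : Type v} [Group Q]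
    (ρ : Q →* Aut Y) (hover : ∀ q, (ρ q).hom ≫ π = π)
    (htransE : ∀ e e' : Y.Edge, π.edgeMap e = π.edgeMap e' → ∃ q, (ρ q).hom.edgeMap e = e')
    (hfree : ∀ (q : Q) (x : Y.Vertex), (ρ q).hom.vertexMap x = x → ρ q = 1)
    (hY : Y.IsConnected) (hT : T.IsTree) :
    Function.Injective (Sum.map π.vertexMap (Sum.map π.edgeMap π.branchMap) : Y.Node → T.Node) := by
  -- the node map of `π` on barycentric subdivisions, a graph homomorphism
  let f : Y.subdivision →g T.subdivision :=
    ⟨Sum.map π.vertexMap (Sum.map π.edgeMap π.branchMap), fun h => subdivision_adj_map π h⟩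
  -- it is locally injective
  have hloc : ∀ ⦃x y z : Y.Node⦄, Y.subdivision.Adj x y → Y.subdivision.Adj x z → f y = f z →
      y = z := by
    intro x y z hy hz hyz
    change Sum.map π.vertexMap (Sum.map π.edgeMap π.branchMap) y =
      Sum.map π.vertexMap (Sum.map π.edgeMap π.branchMap) z at hyz
    rcases x with v | e | b
    · -- at a vertex node: freeness of the action and transitivity on edge fibres
      obtain ⟨b₁, hb₁, rfl⟩ := (Y.subdivision_adj_inl_iff v y).1 hy
      obtain ⟨b₂, hb₂, rfl⟩ := (Y.subdivision_adj_inl_iff v z).1 hz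
      have h : π.branchMap b₁ = π.branchMap b₂ := by simpa using hyz
      have he : π.edgeMap (Y.edgeOf b₁) = π.edgeMap (Y.edgeOf b₂) := by
        rw [← π.edgeOf_branchMap, ← π.edgeOf_branchMap, h]
      obtain ⟨q, hq⟩ := htransE _ _ he
      -- `q b₁` is the branch of `q e₁ = e₂` over `π b₁ = π b₂`, hence `q b₁ = b₂`
      have hqb : (ρ q).hom.branchMap b₁ = b₂ := by
        refine π.branchMap_injOn _ _ ?_ ?_
        · rw [(ρ q).hom.edgeOf_branchMap, hq]
        · have h1 := congrArg (fun φ : Y ⟶ T => φ.branchMap b₁) (hover q)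
          exact h1.trans h
      -- hence `q v = v`, so `q` acts trivially
      have hqv : (ρ q).hom.vertexMap v = v := by
        have h1 := (ρ q).hom.abuts_branchMap b₁ v hb₁
        rw [hqb, hb₂] at h1
        exact (Option.some.inj h1).symm
      have h1 : ρ q = 1 := hfree q v hqv
      rw [h1] at hqb
      change b₁ = b₂ at hqb
      rw [hqb]
    · obtain ⟨b₁, hb₁, rfl⟩ := (Y.subdivision_adj_edge_iff e y).1 hy
      obtain ⟨b₂, hb₂, rfl⟩ := (Y.subdivision_adj_edge_iff e z).1 hz
      have h : π.branchMap b₁ = π.branchMap b₂ := by simpa using hyz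
      rw [π.branchMap_injOn b₁ b₂ (hb₁.trans hb₂.symm) h]
    · rcases (Y.subdivision_adj_branch_iff b y).1 hy with rfl | ⟨v₁, hv₁, rfl⟩ <;>
        rcases (Y.subdivision_adj_branch_iff b z).1 hz with rfl | ⟨v₂, hv₂, rfl⟩
      · rfl
      · simp at hyz
      · simp at hyz
      · rw [hv₁] at hv₂
        cases hv₂
        rfl
  exact hom_injective_of_locallyInjective f hY.connected.preconnected hT.isTree.isAcyclic hloc

/-- Vertex form of the engine: under the same hypotheses `π` is injective on vertices.
[cite: MochizukiSemiAnbd2006, Thm 3.7(iii) p.41] -/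
theorem vertexMap_injective_of_free_of_isTree {Y T : SemiGraph.{u}} (π : Y ⟶ T) {Q : Type v} [Group Q]
    (ρ : Q →* Aut Y) (hover : ∀ q, (ρ q).hom ≫ π = π)
    (htransE : ∀ e e' : Y.Edge, π.edgeMap e = π.edgeMap e' → ∃ q, (ρ q).hom.edgeMap e = e')
    (hfree : ∀ (q : Q) (x : Y.Vertex), (ρ q).hom.vertexMap x = x → ρ q = 1)
    (hY : Y.IsConnected) (hT : T.IsTree) : Function.Injective π.vertexMap := by
  intro x x' h
  have hinj := nodeMap_injective_of_free_of_isTree π ρ hover htransE hfree hY hT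
  have h1 := @hinj (Sum.inl x) (Sum.inl x') (by simp [h])
  simpa using h1

/-! ### Coset semi-graphs: normality of `vertSup`, stabilisers and fibres -/

namespace SubgroupPresentation

variable {𝔾 : SemiGraph.{u}} {Γ : Type u} [Group Γ] (P : SubgroupPresentation 𝔾 Γ)

/-- Conjugation permutes the pieces `N ∩ g H_w g⁻¹` of `vertSup N` (`N` normal).
[cite: MochizukiSemiAnbd2006, Thm 3.7(iii) p.41] -/
theorem map_conj_vertSup_le (N : Subgroup Γ) [N.Normal] (γ : Γ) :
    (P.vertSup N).map (MulAut.conj γ).toMonoidHom ≤ P.vertSup N := by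
  unfold vertSup
  rw [Subgroup.map_iSup]
  refine iSup_le fun p => le_trans ?_ (P.inf_map_conj_le_vertSup N p.1 (γ * p.2))
  rintro _ ⟨y, hy, rfl⟩
  obtain ⟨hyN, hyH⟩ := Subgroup.mem_inf.mp hy
  refine Subgroup.mem_inf.mpr ⟨?_, ?_⟩
  · simpa only [MulEquiv.coe_toMonoidHom, MulAut.conj_apply] using
      Subgroup.Normal.conj_mem ‹N.Normal› y hyN γ
  · obtain ⟨h, hh, rfl⟩ := hyH
    refine ⟨h, hh, ?_⟩
    simp only [MulEquiv.coe_toMonoidHom, MulAut.conj_apply]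
    group

/-- **`vertSup N` is a normal subgroup** for normal `N`. [cite: MochizukiSemiAnbd2006, Thm 3.7(iii) p.41] -/
theorem vertSup_normal (N : Subgroup Γ) [N.Normal] : (P.vertSup N).Normal :=
  ⟨fun x hx γ => by
    have h := P.map_conj_vertSup_le N γ ⟨x, hx, rfl⟩
    simpa only [MulEquiv.coe_toMonoidHom, MulAut.conj_apply] using h⟩

/-- **Vertex stabilisers of `N` on `cosetGraph L` lie in `L`** when `vertSup N ≤ L ≤ N` (`L`, `N` normal):
if `n ∈ N` fixes the class `H_w y L`, then `y n y⁻¹ ∈ H_w · L`, so `n ∈ (N ∩ y⁻¹ H_w y) · L ≤ L`.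
[cite: MochizukiSemiAnbd2006, Thm 3.7(iii) p.41] -/
theorem mem_of_deckAct_vMk_eq {L N : Subgroup Γ} [L.Normal] [N.Normal] (hVL : P.vertSup N ≤ L)
    (hLN : L ≤ N) {n : Γ} (hn : n ∈ N) {w : 𝔾.Vertex} {y : Γ}
    (h : (P.deckAct L n).hom.vertexMap (P.vMk L w y) = P.vMk L w y) : n ∈ L := by
  rw [P.deckAct_fixes_vMk_iff] at h
  obtain ⟨a, ha, k, hk, hak⟩ := Set.mem_mul.mp h
  -- `a = y n y⁻¹ k⁻¹`
  have ha' : a = y * n * y⁻¹ * k⁻¹ := by rw [← hak]; group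
  subst ha'
  -- `c := y⁻¹ a y = n · (y⁻¹ k⁻¹ y) ∈ N ∩ y⁻¹ H_w y ≤ vertSup N ≤ L`
  have hcN : y⁻¹ * (y * n * y⁻¹ * k⁻¹) * y ∈ N := by
    have h1 : y⁻¹ * (y * n * y⁻¹ * k⁻¹) * y = n * (y⁻¹ * k⁻¹ * y⁻¹⁻¹) := by group
    rw [h1]
    exact N.mul_mem hn (Subgroup.Normal.conj_mem ‹N.Normal› _ (N.inv_mem (hLN hk)) y⁻¹)
  have hcH : y⁻¹ * (y * n * y⁻¹ * k⁻¹) * y ∈ (P.H w).map (MulAut.conj y⁻¹).toMonoidHom := by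
    refine ⟨_, ha, ?_⟩
    simp only [MulEquiv.coe_toMonoidHom, MulAut.conj_apply, inv_inv]
  have hc : y⁻¹ * (y * n * y⁻¹ * k⁻¹) * y ∈ L :=
    hVL (P.inf_map_conj_le_vertSup N w y⁻¹ (Subgroup.mem_inf.mpr ⟨hcN, hcH⟩))
  have h2 : n = (y⁻¹ * (y * n * y⁻¹ * k⁻¹) * y) * (y⁻¹ * k * y⁻¹⁻¹) := by group
  rw [h2]
  exact L.mul_mem hc (Subgroup.Normal.conj_mem ‹L.Normal› k hk y⁻¹)

/-- **The edge fibres of `cosetGraph L ⟶ cosetGraph N` are `N`-orbits** of the deck action (`L ≤ N`,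
`L` normal): `M_e y N = M_e y' N` iff `M_e y' L = deck(n) (M_e y L)` for some `n ∈ N`.
[cite: MochizukiSemiAnbd2006, Thm 3.7(iii) p.41] -/
theorem exists_deckAct_eMk_eq {L N : Subgroup Γ} [L.Normal] (hLN : L ≤ N) {e : 𝔾.Edge} {y y' : Γ}
    (h : P.eMk N e y = P.eMk N e y') :
    ∃ n ∈ N, (P.deckAct L n).hom.edgeMap (P.eMk L e y) = P.eMk L e y' := by
  have _ := hLN
  rw [P.eMk_eq_eMk_iff, DoubleCoset.eq] at h
  obtain ⟨m, hm, n, hn, hy'⟩ := h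
  refine ⟨n⁻¹, N.inv_mem hn, ?_⟩
  rw [P.deckAct_edgeMap_eMk, inv_inv, P.eMk_eq_eMk_iff, DoubleCoset.eq]
  exact ⟨m, hm, 1, L.one_mem, by rw [hy', mul_one, mul_assoc]⟩

/-- Elements of `N` act over `cosetGraph N`: `deck_L(n) ≫ trans = trans` (`L ≤ N` normal, `n ∈ N`).
[cite: MochizukiSemiAnbd2006, Thm 3.7(iii) p.41] -/
theorem deckAct_comp_cosetGraphTrans_of_mem {L N : Subgroup Γ} [L.Normal] [N.Normal] (hLN : L ≤ N)
    {n : Γ} (hn : n ∈ N) : (P.deckAct L n).hom ≫ P.cosetGraphTrans hLN = P.cosetGraphTrans hLN := by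
  rw [P.deckAct_trans hLN, P.deckAct_eq_one_of_mem N hn]
  exact Category.comp_id _

/-- **Connectedness passes up the tower**: if `P.cosetGraph K` is connected and `K ≤ L`, then
`P.cosetGraph L` is connected (the transition map is surjective on vertices, edges and branches).
[cite: MochizukiSemiAnbd2006, Thm 3.7(iii) p.41] -/
theorem isConnected_cosetGraph_of_le {K L : Subgroup Γ} (hKL : K ≤ L)
    (hK : (P.cosetGraph K).IsConnected) : (P.cosetGraph L).IsConnected := by
  let f : (P.cosetGraph K).subdivision →g (P.cosetGraph L).subdivision :=
    ⟨Sum.map (P.cosetGraphTrans hKL).vertexMap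
      (Sum.map (P.cosetGraphTrans hKL).edgeMap (P.cosetGraphTrans hKL).branchMap),
      fun h => subdivision_adj_map _ h⟩
  have hf : Function.Surjective f := by
    rintro (x | x | x)
    · obtain ⟨w, y, rfl⟩ := P.vMk_surjective L x
      exact ⟨Sum.inl (P.vMk K w y), rfl⟩
    · obtain ⟨e, y, rfl⟩ := P.eMk_surjective L x
      exact ⟨Sum.inr (Sum.inl (P.eMk K e y)), rfl⟩
    · obtain ⟨b, y, rfl⟩ := P.bMk_surjective L x
      exact ⟨Sum.inr (Sum.inr (P.bMk K b y)), rfl⟩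
  exact ⟨hK.connected.map f hf⟩

/-! ### The theorem: a tree level is generated by its vertex groups over a connected level -/

/-- **A tree level is its verticially generated part over any connected intermediate level**: for
normal levels `L ≤ N` with `P.vertSup N ≤ L`, `P.cosetGraph L` connected and `P.cosetGraph N` a tree
(`𝔾` with a vertex `w₀`), `N ≤ L` — the deck action of `N/L` on `cosetGraph L` is free on vertices with
orbit fibres over the tree `cosetGraph N`, so `cosetGraph L ⟶ cosetGraph N` is injective on vertices by
the engine, and `H_{w₀} n⁻¹ L = H_{w₀} L` for every `n ∈ N`. [cite: MochizukiSemiAnbd2006, Thm 3.7(iii) p.41] -/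
theorem le_of_isTree_of_vertSup_le {L N : Subgroup Γ} [L.Normal] [N.Normal] (hLN : L ≤ N)
    (hVL : P.vertSup N ≤ L) (hL : (P.cosetGraph L).IsConnected) (hN : (P.cosetGraph N).IsTree)
    (w₀ : 𝔾.Vertex) : N ≤ L := by
  -- the deck action of `N` on `cosetGraph L`, over `cosetGraph N`
  have hover : ∀ q : N, (((P.deckAct L).comp N.subtype) q).hom ≫ P.cosetGraphTrans hLN =
      P.cosetGraphTrans hLN :=
    fun q => P.deckAct_comp_cosetGraphTrans_of_mem hLN q.2
  have htransE : ∀ x x' : (P.cosetGraph L).Edge,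
      (P.cosetGraphTrans hLN).edgeMap x = (P.cosetGraphTrans hLN).edgeMap x' →
        ∃ q : N, (((P.deckAct L).comp N.subtype) q).hom.edgeMap x = x' := by
    intro x x' hx
    obtain ⟨e, y, rfl⟩ := P.eMk_surjective L x
    obtain ⟨e', y', rfl⟩ := P.eMk_surjective L x'
    change P.eMk N e y = P.eMk N e' y' at hx
    obtain rfl : e = e' := congrArg Sigma.fst hx
    obtain ⟨n, hn, h⟩ := P.exists_deckAct_eMk_eq hLN hx
    exact ⟨⟨n, hn⟩, h⟩
  have hfree : ∀ (q : N) (x : (P.cosetGraph L).Vertex),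
      (((P.deckAct L).comp N.subtype) q).hom.vertexMap x = x → ((P.deckAct L).comp N.subtype) q = 1 := by
    intro q x hx
    obtain ⟨w, y, rfl⟩ := P.vMk_surjective L x
    exact P.deckAct_eq_one_of_mem L (P.mem_of_deckAct_vMk_eq hVL hLN q.2 hx)
  have hinj := vertexMap_injective_of_free_of_isTree (P.cosetGraphTrans hLN)
    ((P.deckAct L).comp N.subtype) hover htransE hfree hL hN
  intro n hn
  -- `H_{w₀} n⁻¹ N = H_{w₀} N`, hence `H_{w₀} n⁻¹ L = H_{w₀} L` by injectivity, i.e. `n` fixes a vertex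
  have h1 : (P.cosetGraphTrans hLN).vertexMap (P.vMk L w₀ (1 * n⁻¹)) =
      (P.cosetGraphTrans hLN).vertexMap (P.vMk L w₀ 1) := by
    change P.vMk N w₀ (1 * n⁻¹) = P.vMk N w₀ 1
    rw [P.vMk_eq_vMk_iff, DoubleCoset.eq]
    exact ⟨1, one_mem _, n, hn, by group⟩
  refine P.mem_of_deckAct_vMk_eq hVL hLN hn (w := w₀) (y := 1) ?_
  rw [P.deckAct_vertexMap_vMk]
  exact hinj h1

/-- **A tree level is generated by its vertex groups over any connected lower level**: for normal
levels `K ≤ N` with `P.cosetGraph K` connected and `P.cosetGraph N` a TREE (`𝔾` with a vertex),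
`N ≤ K ⊔ P.vertSup N` — "the kernel of `π₁^temp(𝒢_i) ↠ π₁(𝔾_i)` modulo a deeper tree level is generated
by the verticial subgroups" (the deck group `N/K` of the tree `cosetGraph K` over the tree `cosetGraph N`
is generated by its vertex stabilisers). [cite: MochizukiSemiAnbd2006, Thm 3.7(iii) p.41] -/
theorem le_sup_vertSup_of_isTree {K N : Subgroup Γ} [K.Normal] [N.Normal] (hKN : K ≤ N)
    (hK : (P.cosetGraph K).IsConnected) (hN : (P.cosetGraph N).IsTree) (w₀ : 𝔾.Vertex) :
    N ≤ K ⊔ P.vertSup N := by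
  haveI := P.vertSup_normal N
  exact P.le_of_isTree_of_vertSup_le (L := K ⊔ P.vertSup N) (sup_le hKN (P.vertSup_le N))
    le_sup_right (P.isConnected_cosetGraph_of_le le_sup_left hK) hN w₀

/-- Equality form: `N = K ⊔ P.vertSup N`. [cite: MochizukiSemiAnbd2006, Thm 3.7(iii) p.41] -/
theorem eq_sup_vertSup_of_isTree {K N : Subgroup Γ} [K.Normal] [N.Normal] (hKN : K ≤ N)
    (hK : (P.cosetGraph K).IsConnected) (hN : (P.cosetGraph N).IsTree) (w₀ : 𝔾.Vertex) :
    N = K ⊔ P.vertSup N :=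
  le_antisymm (P.le_sup_vertSup_of_isTree hKN hK hN w₀) (sup_le hKN (P.vertSup_le N))

end SubgroupPresentation

end SemiGraph

end Literature.AnabelianGeometry.SemiGraphs
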